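import Summits.QuantumFields.BalabanUV.Beta.EriceRemainderEnclosureHistoryAutonomyComparisonTowerLemmas

/-!
# EriceRemainderEnclosureHistoryAutonomyComparisonZones — (E62c) PROFILE-BOUNDED ZONES, HYPER-SEPARATED, MULTIPLY: `B(u) = b + Σ_{k∈A} L_k·u_k` with the
# finite support `A ⊆ [1, K[` partitioned into ZONES by any map `z` (ages in different zones have ratio `≤ t`, ages in one zone are unrestricted), EVERY
# zone passing (E58b)'s profile condition with a margin, `Σ_{j ∈ zone} L_j ∕ P_j ≤ 2q` (`P_j = Σ_{k<K} L_k·√(j∕(j+k))`, `0 ≤ q ≤ 1`), and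
# **`(n² + 4)·t ≤ 2·(1 − q)^N`** (`n = #A` ages, `N` zones): every `B′ ≥ B` with a zeroth moment and an ISOTONE excess gives `h′ ≤ h` at every scale from
# every pin (`le_of_isotone_excess_zones`) — ONE zone (`t = 0`) IS (E58b)'s profile theorem, SINGLETON zones (`q = √2∕2`) ARE (E62b)'s towers: the
# level-weight bookkeeping holds INSIDE each zone and the budget MULTIPLIES ACROSS zones (`budget_prod`: `(1−2t)·Σ_ζ D_ζ ≤ η₊·(1 − Π_ζ (1 − Q_ζ(1−2t)))`)

Cell `pub-balaban`, β-function sub-cell, BINDER row D4 «RemainderConst leaves for Bałaban's split» (`HOME/BINDER-OWNERS.md`; owner lineage `b2b-balaban-beta-an4`;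
this file by co-owner #2 lineage `b2b-balaban-beta-d4-p2`, generation 55), β-FLOW TEAM duty (1), FREEZE (0) honoured (def-free; (E62a)'s `sum_support` ∕ `drop_le` ∕
`old_drop_window` ∕ `window_sum_ge`, (E58b)'s `weight_le_profile`, (E58a)'s `le_of_isotone_excess_of_step`, (E49j)'s `excess_shift_le`, (E48a)'s
`strictAnti_of_memFlow`, (E41)'s `affine_monotone` ∕ `affine_floor` ∕ `affine_zerothMoment`, node U2's `SeqBox` ∕ `MemFlow` ∕ `Sharpness.abs_sub_le_half_cube_mul`
BY NAME; nothing restated).  Sequel of (E62b) `…ComparisonTower` (hyper-separated single ages) and (E58b) `…ComparisonAffineProfile` (one block under the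
profile condition): their common generalisation.

HONEST FRAMING (page 1, verbatim and binding).  *"Discharging BetaPertH makes Bałaban's UV stability UNCONDITIONAL — a real constructive-QFT result; it is
NOT the continuum limit and NOT the Clay problem."*  THIS FILE DISCHARGES NOTHING OF THE KIND.  Elementary real analysis about ABSTRACT affine functionals on
a box ]0,γ]^ℕ with displayed supports and signs — hypotheses of a census, not facts; the form, signs, ages and moments of Bałaban's (1.22) limit functional
are NOT PRINTED ([I] p. 298; GAPS G-t4-U2-1∕-2) and NOT asserted.  Row D4 class UNCHANGED (critical-path width 0; instance 0∕1; D4 DISCHARGE NO DATE).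
HONEST DEPENDENCY: continuum YM on T⁴ ⇐ BetaPertH ∧ nine spine estimates (0/9 proved); BetaPertH ⇐ (D1) ∧ (D4) ∧ CAP+tail; G-an2-4 gates asym, D1 and
NE2/3/4.

THE POINT (census sense (α); the COMPARISON column of the autonomy row).  (E62b) peeled SINGLE ages, paying each with the crude acceleration `L_k·k·h_k³ ≤ √2`;
(E58b) paid a WHOLE profile at once with its level weight `Q = Σ_k L_k·k·h_k³ ≤ Σ_j L_j∕P_j ≤ 2`.  Here the two bookkeepings are composed: group the ages
into zones `A_ζ = {k ∈ A : z k = ζ}`; for an age `k` the drop is `D_k ≤ L_k·(h_k³∕2)·δ_k ≤ (L_k∕(2P_k))·(δ_k∕k)` ((E58b) `weight_le_profile`) and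
`δ_k ≤ k·η − Σ_{l≤k} d_l` where over the window `l ≤ k` every age `k′` of a HIGHER zone (`k ≤ t·k′`) drops by at least `(1 − 2t)·D_{k′} − (√2∕2)·t·D̄`
((E62a) `old_drop_window`; ages of the same or lower zones are simply dropped) — so the zone drops `D_ζ = Σ_{k∈A_ζ} D_k` solve the triangular system
**`D_ζ ≤ Q_ζ·(η₊ − (1 − 2t)·Σ_{ζ′>ζ} D_{ζ′})`**, `Q_ζ = ½·Σ_{j∈A_ζ} L_j∕P_j`, `η₊ = η(1 + n²t∕2)`, whence (§1 `budget_prod`, induction on the lowest zone)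
`(1 − 2t)·d₀ ≤ η₊·(1 − Π_ζ (1 − Q_ζ(1 − 2t))) ≤ η₊·(1 − (1 − q)^N)` and (§1 `assembly_general`) `d₀ ≤ η` under `(n² + 4)·t ≤ 2·(1 − q)^N`.  CONSEQUENCES:
`N = 1`, `t = 0`: (E58b) verbatim; singleton zones (`L_k∕P_k ≤ √2`, `q = √2∕2`): (E62b); NEW: hyper-separated towers whose storeys are arbitrary
profile-bounded blocks, each with its own margin `q < 1` — ZONES ARE PROFILE-BOUNDED BLOCKS, AND HYPER-SEPARATED ZONES MULTIPLY
(`HOME/b2b-balaban-beta-d4-p2/g54/e61/README.md`).  NOT CLAIMED: zones at ratios below the threshold, blocks with profile sum `≥ 2` (e.g. three unit ages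
in one zone), necessity, anything printed; conjecture (E58′) stays OPEN in general.

WHAT IS PROVED ([folklore]; 0 `def`, 0 sorry).  §1 **`budget_prod`**, `pow_card_le_prod_of_le`, **`assembly_general`**, `t_le_two_fifths`.  §2
**`effective_le_of_family_le_at_zones`** (THE STEP).  §3 **`le_of_isotone_excess_zones`**.
-/
noncomputable section
open Finset Set

namespace Summit.QuantumFields.BalabanUV.Beta.EriceRemainderEnclosureHistoryAutonomyComparisonZones

open Literature.MathematicalPhysics.QuantumFieldTheory.Balaban1983to89
open Literature.MathematicalPhysics.QuantumFieldTheory.Balaban1983to89.T4BetaStationary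
open Literature.MathematicalPhysics.QuantumFieldTheory.Balaban1983to89.T4BetaFlowWellPosed
open Literature.MathematicalPhysics.QuantumFieldTheory.Balaban1983to89.T4BetaFlowWellPosed.Sharpness (abs_sub_le_half_cube_mul)
open Summit.QuantumFields.BalabanUV.Beta.EriceRemainderEnclosureHistoryAutonomyOrder (strictAnti_of_memFlow)
open Summit.QuantumFields.BalabanUV.Beta.EriceRemainderEnclosureHistoryAutonomyComparisonExcess (excess_shift_le)
open Summit.QuantumFields.BalabanUV.Beta.EriceRemainderEnclosureHistoryAutonomyComparisonPrinciple (le_of_isotone_excess_of_step)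
open Summit.QuantumFields.BalabanUV.Beta.EriceRemainderEnclosureHistoryAutonomyComparisonAffineProfile (weight_le_profile)
open Summit.QuantumFields.BalabanUV.Beta.EriceRemainderEnclosureHistoryAutonomyMonotone (affine_monotone affine_floor affine_zerothMoment)
open Summit.QuantumFields.BalabanUV.Beta.EriceRemainderEnclosureHistoryAutonomyComparisonTwoAgesLemmas (sqrt_two_lt)
open Summit.QuantumFields.BalabanUV.Beta.EriceRemainderEnclosureHistoryAutonomyComparisonTowerLemmas

variable {B' : (ℕ → ℝ) → ℝ} {M' γ b y t q : ℝ} {L : ℕ → ℝ} {K : ℕ} {h h' : ℕ → ℝ} {A : Finset ℕ} {z : ℕ → ℕ}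

/-! ## §1 The budget recursion over zones with a factor per zone; the general numerical assembly -/

/-- **THE BUDGET RECURSION OVER ZONES (ZONE PRODUCT LAW, one factor per zone).**  Nonnegative zone drops `D_ζ`, `ζ ∈ Z`, zone weights `Q_ζ` with
`0 ≤ 1 − Q_ζ(1 − 2t)`, `0 ≤ 1 − 2t`, and the triangular system `D_ζ ≤ Q_ζ·η₊ − Q_ζ(1 − 2t)·Σ_{ζ′∈Z, ζ′>ζ} D_{ζ′}`.  Then
`(1 − 2t)·Σ_{ζ∈Z} D_ζ ≤ η₊·(1 − Π_{ζ∈Z} (1 − Q_ζ(1 − 2t)))`: each zone multiplies the budget left to the lower zones by its own factor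
`θ_ζ = 1 − Q_ζ(1−2t)` (induction on the lowest zone). [folklore] -/
theorem budget_prod {D Q : ℕ → ℝ} {t ηp : ℝ} (h2t : 0 ≤ 1 - 2 * t) (Z : Finset ℕ) (hD0 : ∀ ζ ∈ Z, 0 ≤ D ζ)
    (hθ : ∀ ζ ∈ Z, 0 ≤ 1 - Q ζ * (1 - 2 * t))
    (hrec : ∀ ζ ∈ Z, D ζ ≤ Q ζ * ηp - Q ζ * (1 - 2 * t) * ∑ ζ' ∈ Z.filter (fun ζ' => ζ < ζ'), D ζ') :
    (1 - 2 * t) * ∑ ζ ∈ Z, D ζ ≤ ηp * (1 - ∏ ζ ∈ Z, (1 - Q ζ * (1 - 2 * t))) := by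
  induction Z using Finset.induction_on_min with
  | empty => simp
  | insert a s has ih =>
    have hnot : a ∉ s := fun ha => lt_irrefl a (has a ha)
    have hfilt : ∀ ζ ∈ s, (insert a s).filter (fun ζ' => ζ < ζ') = s.filter (fun ζ' => ζ < ζ') := by
      intro ζ hζ
      ext ζ'
      simp only [mem_filter, Finset.mem_insert]
      refine ⟨?_, fun ⟨hζ', hζζ'⟩ => ⟨Or.inr hζ', hζζ'⟩⟩
      rintro ⟨hζ' | hζ', hζζ'⟩
      · exact absurd (hζ'.symm ▸ hζζ' : ζ < a) (not_lt.mpr (has ζ hζ).le)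
      · exact ⟨hζ', hζζ'⟩
    have hS := ih (fun ζ hζ => hD0 ζ (mem_insert_of_mem hζ)) (fun ζ hζ => hθ ζ (mem_insert_of_mem hζ))
      (fun ζ hζ => by rw [← hfilt ζ hζ]; exact hrec ζ (mem_insert_of_mem hζ))
    have hfa : (insert a s).filter (fun ζ' => a < ζ') = s := by
      ext ζ'
      simp only [mem_filter, Finset.mem_insert]
      refine ⟨?_, fun hζ' => ⟨Or.inr hζ', has ζ' hζ'⟩⟩
      rintro ⟨hζ' | hζ', haζ'⟩
      · exact absurd (hζ' ▸ haζ' : a < a) (lt_irrefl a)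
      · exact hζ'
    have ha := hrec a (mem_insert_self a s)
    rw [hfa] at ha
    have hθa := hθ a (mem_insert_self a s)
    set S : ℝ := ∑ ζ ∈ s, D ζ with hS_def
    set θ : ℝ := 1 - Q a * (1 - 2 * t) with hθ_def
    set P : ℝ := ∏ ζ ∈ s, (1 - Q ζ * (1 - 2 * t)) with hP_def
    rw [sum_insert hnot, prod_insert hnot]
    have h1 : (1 - 2 * t) * (D a + S) ≤ (1 - 2 * t) * (Q a * ηp - Q a * (1 - 2 * t) * S + S) :=
      mul_le_mul_of_nonneg_left (by linarith) h2t
    have h2 : θ * ((1 - 2 * t) * S) ≤ θ * (ηp * (1 - P)) := mul_le_mul_of_nonneg_left hS hθa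
    have e1 : (1 - 2 * t) * (Q a * ηp - Q a * (1 - 2 * t) * S + S) = (1 - θ) * ηp + θ * ((1 - 2 * t) * S) := by
      simp only [hθ_def]; ring
    have e2 : (1 - θ) * ηp + θ * (ηp * (1 - P)) = ηp * (1 - θ * P) := by ring
    linarith

/-- A product of factors each at least `θ₀ ≥ 0` is at least `θ₀^{#Z}`. [folklore] -/
theorem pow_card_le_prod_of_le {f : ℕ → ℝ} {θ₀ : ℝ} (Z : Finset ℕ) (hθ₀ : 0 ≤ θ₀) (hf : ∀ ζ ∈ Z, θ₀ ≤ f ζ) :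
    θ₀ ^ Z.card ≤ ∏ ζ ∈ Z, f ζ := by
  rw [← prod_const]
  exact prod_le_prod (fun _ _ => hθ₀) hf

/-- **THE GENERAL NUMERICAL ASSEMBLY**: `t, η, θ₀, E ≥ 0`, `θ₀^N ≤ P`, `(E + 4)·t ≤ 2·θ₀^N` ⟹ `η·(1 + E·t∕2)·(1 − P) ≤ η·(1 − 2t)`. [folklore] -/
theorem assembly_general {t η θ₀ P E : ℝ} {N : ℕ} (ht0 : 0 ≤ t) (hη : 0 ≤ η) (hθ₀ : 0 ≤ θ₀) (hP : θ₀ ^ N ≤ P) (hE : 0 ≤ E)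
    (ht : (E + 4) * t ≤ 2 * θ₀ ^ N) : η * (1 + E * t / 2) * (1 - P) ≤ η * (1 - 2 * t) := by
  have hpow0 : 0 ≤ θ₀ ^ N := pow_nonneg hθ₀ N
  have hx : 0 ≤ E * t / 2 := by positivity
  have h1 : (1 + E * t / 2) * (1 - P) ≤ (1 + E * t / 2) * (1 - θ₀ ^ N) := mul_le_mul_of_nonneg_left (by linarith) (by linarith)
  have h2 : (1 + E * t / 2) * (1 - θ₀ ^ N) ≤ 1 + E * t / 2 - θ₀ ^ N := by nlinarith
  have h3 : 1 + E * t / 2 - θ₀ ^ N ≤ 1 - 2 * t := by linarith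
  calc η * (1 + E * t / 2) * (1 - P) = η * ((1 + E * t / 2) * (1 - P)) := by ring
    _ ≤ η * (1 - 2 * t) := mul_le_mul_of_nonneg_left (h1.trans (h2.trans h3)) hη

/-- Under `(n² + 4)·t ≤ 2·θ₀^N` with `n ≥ 1`, `0 ≤ θ₀ ≤ 1`: `t ≤ 2∕5`. [folklore] -/
theorem t_le_two_fifths {t θ₀ : ℝ} {n N : ℕ} (hn : 1 ≤ n) (hθ₀ : 0 ≤ θ₀) (hθ₁ : θ₀ ≤ 1) (ht : ((n : ℝ) ^ 2 + 4) * t ≤ 2 * θ₀ ^ N) :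
    t ≤ 2 / 5 := by
  have hpow : θ₀ ^ N ≤ 1 := pow_le_one₀ hθ₀ hθ₁
  have hn1 : (1 : ℝ) ≤ n := by exact_mod_cast hn
  nlinarith

/-! ## §2 THE STEP for profile-bounded, hyper-separated zones -/

/-- **THE STEP FOR PROFILE-BOUNDED HYPER-SEPARATED ZONES.**  `B(u) = b + Σ_{k<K} L_k·u_k` with `L ≥ 0` supported on a finite `A ⊆ [1, K[`; a zone map `z`;
ages in different zones separated, `k ≤ t·k′` whenever `z k < z k′` (`t ≥ 0`); every zone passes the profile condition with margin `q ∈ [0, 1]`,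
`Σ_{j∈A, z j = ζ} L_j ∕ P_j ≤ 2q`, `P_j = Σ_{k<K} L_k·√(j∕(j+k))`; and `(n² + 4)·t ≤ 2·(1 − q)^N`, `n = #A`, `N = #z(A)`.  `B ≤ B′` on the box with ISOTONE
excess; `h`, `h′` box solutions of `B`, `B′` from one pin `y` with `h′ ≤ h` at every scale.  Then `B h ≤ B′ h′`. [folklore] -/
theorem effective_le_of_family_le_at_zones (hL : ∀ k, 0 ≤ L k) (hb : 0 < b) (hAK : A ⊆ range K) (hA1 : ∀ k ∈ A, 1 ≤ k)
    (hsupp : ∀ k ∈ range K, k ∉ A → L k = 0) (ht0 : 0 ≤ t) (hsep : ∀ k ∈ A, ∀ k' ∈ A, z k < z k' → (k : ℝ) ≤ t * k')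
    (hq0 : 0 ≤ q) (hq1 : q ≤ 1)
    (hzone : ∀ ζ ∈ A.image z, ∑ j ∈ A.filter (fun j => z j = ζ), L j / ∑ k ∈ range K, L k * Real.sqrt ((j : ℝ) / ((j : ℝ) + k)) ≤ 2 * q)
    (ht : ((A.card : ℝ) ^ 2 + 4) * t ≤ 2 * (1 - q) ^ (A.image z).card)
    (hexc : ∀ u, SeqBox γ u → (fun u : ℕ → ℝ => b + ∑ k ∈ range K, L k * u k) u ≤ B' u)
    (hDmono : ∀ u v : ℕ → ℝ, SeqBox γ u → SeqBox γ v → (∀ j, u j ≤ v j) →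
      B' u - (fun u : ℕ → ℝ => b + ∑ k ∈ range K, L k * u k) u ≤ B' v - (fun u : ℕ → ℝ => b + ∑ k ∈ range K, L k * u k) v)
    (hy : 0 < y) (hh : SeqBox γ h) (hf : MemFlow (fun u : ℕ → ℝ => b + ∑ k ∈ range K, L k * u k) y h) (hh' : SeqBox γ h')
    (hf' : MemFlow B' y h') (hle : ∀ j, h' j ≤ h j) :
    (fun u : ℕ → ℝ => b + ∑ k ∈ range K, L k * u k) h ≤ B' h' := by
  set B : (ℕ → ℝ) → ℝ := fun u : ℕ → ℝ => b + ∑ k ∈ range K, L k * u k with hB_def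
  have hlo : ∀ u, SeqBox γ u → b ≤ B u := affine_floor hL
  have hlo' : ∀ u, SeqBox γ u → b ≤ B' u := fun u hu => (hlo u hu).trans (hexc u hu)
  have hdom : ∀ u, SeqBox γ u → ∑ k ∈ range K, L k * u k ≤ B u := fun u _ => by simp only [hB_def]; linarith
  have hanti' : Antitone h' := (strictAnti_of_memFlow hb hlo' hh' hf').antitone
  -- the excess at the pin and along h′
  set η : ℝ := B' h' - B h' with hη_def
  have hη0 : 0 ≤ η := by rw [hη_def]; linarith [hexc h' hh']
  have hηs : ∀ n, |B (fun j => h' (n + 1 + j)) - B' (fun j => h' (n + 1 + j))| ≤ η := excess_shift_le hexc hDmono hh' hanti'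
  -- gaps and level gaps
  have hg0 : ∀ n, 0 ≤ h n - h' n := fun n => by linarith [hle n]
  set δ : ℕ → ℝ := fun n => 1 / h' n ^ 2 - 1 / h n ^ 2 with hδ_def
  have hδ0 : ∀ n, 0 ≤ δ n := fun n =>
    sub_nonneg.mpr (one_div_le_one_div_of_le (pow_pos (hh' n).1 2) (pow_le_pow_left₀ (hh' n).1.le (hle n) 2))
  have hgδ : ∀ n, h n - h' n ≤ h n ^ 3 / 2 * δ n := by
    intro n
    have hw := abs_sub_le_half_cube_mul (hh n).1 (hh' n).1 le_rfl (hle n)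
    rwa [abs_of_nonneg (hg0 n), abs_sub_comm, abs_of_nonneg (hδ0 n)] at hw
  -- the drop read at scale n
  set dd : ℕ → ℝ := fun n => ∑ k ∈ A, L k * (h (n + k) - h' (n + k)) with hdd_def
  have hdrop_eq : ∀ n, B (fun j => h (n + j)) - B (fun j => h' (n + j)) = dd n := by
    intro n
    simp only [hB_def, hdd_def]
    rw [add_sub_add_left_eq_sub, ← sum_sub_distrib,
      show ∑ x ∈ range K, (L x * h (n + x) - L x * h' (n + x)) = ∑ x ∈ range K, L x * (h (n + x) - h' (n + x)) from
        sum_congr rfl fun x _ => by ring,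
      sum_support hAK hsupp]
  have hdd0 : ∀ n, 0 ≤ dd n := fun n => sum_nonneg fun k _ => mul_nonneg (hL k) (hg0 _)
  -- the increment identity
  have hinc : ∀ n, δ (n + 1) - δ n ≤ η - dd (n + 1) ∧ -dd (n + 1) ≤ δ (n + 1) - δ n := by
    intro n
    have e1 := hf.2 n
    have e2 := hf'.2 n
    have hd := hdrop_eq (n + 1)
    have ex1 := (abs_le.mp (hηs n)).1
    have ex0 : B (fun j => h' (n + 1 + j)) ≤ B' (fun j => h' (n + 1 + j)) := hexc _ (seqBox_shift hh' (n + 1))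
    simp only [hδ_def]; constructor <;> linarith
  have hδ_zero : δ 0 = 0 := by simp only [hδ_def]; rw [hf.1, hf'.1]; ring
  have hδle : ∀ n : ℕ, δ n ≤ (n : ℝ) * η := by
    intro n
    induction n with
    | zero => rw [hδ_zero]; simp
    | succ n ih =>
      have := (hinc n).1; have := hdd0 (n + 1)
      rw [Nat.cast_succ]; linarith
  have hδup : ∀ m : ℕ, δ m ≤ (m : ℝ) * η - ∑ l ∈ range m, dd (l + 1) := by
    intro m
    induction m with
    | zero => rw [hδ_zero]; simp
    | succ m ih =>
      have := (hinc m).1; rw [Nat.cast_succ, sum_range_succ]; linarith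
  have hδdown : ∀ n l : ℕ, δ n - ∑ i ∈ range l, dd (n + 1 + i) ≤ δ (n + l) := by
    intro n l
    induction l with
    | zero => simp
    | succ l ih =>
      have := (hinc (n + l)).2
      rw [sum_range_succ, show n + (l + 1) = n + l + 1 by ring, show n + 1 + l = n + l + 1 by ring]
      linarith
  -- the zones
  set Z : Finset ℕ := A.image z with hZ_def
  have hmaps : ∀ k ∈ A, z k ∈ Z := fun k hk => mem_image_of_mem z hk
  -- the numerical side conditions: 0 ≤ 1 − 2t; t ≤ 2/5 for a nonempty support
  have htle : A.Nonempty → t ≤ 2 / 5 := fun hA => t_le_two_fifths (card_pos.mpr hA) (by linarith) (by linarith) ht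
  have h2t : 0 ≤ 1 - 2 * t := by
    rcases A.eq_empty_or_nonempty with hA | hA
    · have h0 : A.card = 0 := by rw [hA, Finset.card_empty]
      have hZ0 : Z.card = 0 := by rw [hZ_def, hA, Finset.image_empty, Finset.card_empty]
      have ht' := ht
      rw [h0, hZ0] at ht'
      norm_num at ht'
      linarith
    · linarith [htle hA]
  -- constants: c = √2/2 for the uniform drop bound D̄ = n·c·η; the enlarged budget η₊ = η(1 + n²t/2)
  set c : ℝ := Real.sqrt 2 / 2 with hc_def
  have hc0 : 0 ≤ c := by rw [hc_def]; positivity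
  have hcc : c * c = 1 / 2 := by
    rw [hc_def, div_mul_div_comm, Real.mul_self_sqrt (by norm_num : (0:ℝ) ≤ 2)]; norm_num
  set Dbar : ℝ := (A.card : ℝ) * (c * η) with hDbar_def
  have hDbar0 : 0 ≤ Dbar := by positivity
  have hDbar : ∀ m, dd m ≤ Dbar := fun m => drop_le hL hb hy hh hf hh' hle hη0 hδle hAK hA1 m
  set ηp : ℝ := η * (1 + (A.card : ℝ) ^ 2 * t / 2) with hηp_def
  -- the drops at the pin, per age and per zone; the profile weights
  set Dk : ℕ → ℝ := fun k => L k * (h k - h' k) with hDk_def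
  have hDk0 : ∀ k, 0 ≤ Dk k := fun k => mul_nonneg (hL k) (hg0 k)
  have hP0 : ∀ j : ℕ, 0 ≤ ∑ k ∈ range K, L k * Real.sqrt ((j : ℝ) / ((j : ℝ) + k)) :=
    fun j => sum_nonneg fun k _ => mul_nonneg (hL k) (Real.sqrt_nonneg _)
  set qk : ℕ → ℝ := fun j => L j / (∑ k ∈ range K, L k * Real.sqrt ((j : ℝ) / ((j : ℝ) + k))) / 2 with hqk_def
  have hqk0 : ∀ k, 0 ≤ qk k := fun k => by
    simp only [hqk_def]; exact div_nonneg (div_nonneg (hL k) (hP0 k)) (by norm_num)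
  set DZ : ℕ → ℝ := fun ζ => ∑ k ∈ A.filter (fun k => z k = ζ), Dk k with hDZ_def
  set QZ : ℕ → ℝ := fun ζ => ∑ k ∈ A.filter (fun k => z k = ζ), qk k with hQZ_def
  have hDZ0 : ∀ ζ, 0 ≤ DZ ζ := fun ζ => sum_nonneg fun k _ => hDk0 k
  have hQZ0 : ∀ ζ, 0 ≤ QZ ζ := fun ζ => sum_nonneg fun k _ => hqk0 k
  have hQZq : ∀ ζ ∈ Z, QZ ζ ≤ q := by
    intro ζ hζ
    have := hzone ζ hζ
    have e : QZ ζ = (∑ j ∈ A.filter (fun j => z j = ζ),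
        L j / ∑ k ∈ range K, L k * Real.sqrt ((j : ℝ) / ((j : ℝ) + k))) / 2 := by
      simp only [hQZ_def, hqk_def]; rw [sum_div]
    rw [e]; linarith
  have hdrop0 : B h - B h' = ∑ k ∈ A, Dk k := by
    have := hdrop_eq 0
    simp only [hdd_def, zero_add] at this
    simpa [hDk_def] using this
  -- the older-zone total seen by zone ζ
  set S : ℕ → ℝ := fun ζ => ∑ k' ∈ A.filter (fun k' => ζ < z k'), Dk k' with hS_def
  -- PER AGE: D_k ≤ q_k·(η₊ − (1 − 2t)·S(z k))
  have hage : ∀ k ∈ A, Dk k ≤ qk k * (ηp - (1 - 2 * t) * S (z k)) := by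
    intro k hk
    have hk1 := hA1 k hk
    have hkK := hAK hk
    have hkr : (0 : ℝ) < k := by exact_mod_cast hk1
    -- (i) D_k ≤ (q_k/k)·δ_k by the profile weight
    have hwp := weight_le_profile (affine_monotone hL) hL hb hlo hdom hy hh hf hkK
    have h1 : Dk k ≤ qk k / k * δ k := by
      have e : L k * (h k ^ 3 / 2) = L k * k * h k ^ 3 / (2 * k) := by rw [eq_div_iff (by positivity)]; ring
      have hq : L k * (h k ^ 3 / 2) ≤ qk k / k := by
        rw [e, show qk k / k = L k / (∑ k' ∈ range K, L k' * Real.sqrt ((k : ℝ) / ((k : ℝ) + k'))) / (2 * k) by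
          simp only [hqk_def]; rw [div_div]]
        exact div_le_div_of_nonneg_right hwp (by positivity)
      calc Dk k = L k * (h k - h' k) := by simp only [hDk_def]
        _ ≤ L k * (h k ^ 3 / 2 * δ k) := mul_le_mul_of_nonneg_left (hgδ k) (hL k)
        _ = L k * (h k ^ 3 / 2) * δ k := by ring
        _ ≤ qk k / k * δ k := mul_le_mul_of_nonneg_right hq (hδ0 k)
    -- (ii) δ_k ≤ k·η − Σ_{l<k} dd(l+1)
    have h2 := hδup k
    -- (iii) over the window every age of a higher zone drops by at least (1−2t)·D_{k′} − c·t·D̄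
    have hW : ∀ l ∈ range k, (1 - 2 * t) * S (z k) - (A.card : ℝ) * (c * t * Dbar) ≤ dd (l + 1) := by
      intro l hl
      have hl' : l + 1 ≤ k := mem_range.mp hl
      have hold : ∀ k' ∈ A.filter (fun k' => z k < z k'),
          (1 - 2 * t) * Dk k' - c * t * Dbar ≤ L k' * (h (l + 1 + k') - h' (l + 1 + k')) := by
        intro k' hk'
        obtain ⟨hk'A, hkk'⟩ := mem_filter.mp hk'
        have hk'1 := hA1 k' hk'A
        have hk'K := hAK hk'A
        have hlt : ((l + 1 : ℕ) : ℝ) ≤ t * k' := le_trans (by exact_mod_cast hl') (hsep k hk k' hk'A hkk')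
        have hE : ∑ i ∈ range (l + 1), dd (k' + 1 + i) ≤ ((l + 1 : ℕ) : ℝ) * Dbar := by
          calc ∑ i ∈ range (l + 1), dd (k' + 1 + i) ≤ ∑ _i ∈ range (l + 1), Dbar := sum_le_sum fun i _ => hDbar _
            _ = ((l + 1 : ℕ) : ℝ) * Dbar := by rw [sum_const, card_range, nsmul_eq_mul]
        have hlev : δ k' - ((l + 1 : ℕ) : ℝ) * Dbar ≤ δ (k' + (l + 1)) := by linarith [hδdown k' (l + 1)]
        have hwin := old_drop_window hL hb hy hh hf hh' hle hk'K hk'1 l hlt hDbar0 (by simp only [hδ_def] at hlev; exact hlev)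
        rw [show l + 1 + k' = k' + (l + 1) by ring]
        simp only [hDk_def, hc_def]
        exact hwin
      have hsumold := sum_le_sum hold
      have hsub : ∑ k' ∈ A.filter (fun k' => z k < z k'), L k' * (h (l + 1 + k') - h' (l + 1 + k')) ≤ dd (l + 1) := by
        simp only [hdd_def]
        exact sum_le_sum_of_subset_of_nonneg (filter_subset _ _) fun k' _ _ => mul_nonneg (hL k') (hg0 _)
      have hcount : ∑ k' ∈ A.filter (fun k' => z k < z k'), ((1 - 2 * t) * Dk k' - c * t * Dbar)
          = (1 - 2 * t) * S (z k) - ((A.filter (fun k' => z k < z k')).card : ℝ) * (c * t * Dbar) := by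
        rw [sum_sub_distrib, ← mul_sum, sum_const, nsmul_eq_mul]
      have hcard : ((A.filter (fun k' => z k < z k')).card : ℝ) ≤ A.card := by exact_mod_cast card_filter_le _ _
      have hctD : 0 ≤ c * t * Dbar := by positivity
      have := mul_le_mul_of_nonneg_right hcard hctD
      linarith
    -- (iv) the window sum and the row of the system
    have h4 := window_sum_ge hW
    have h5 : Dk k ≤ qk k / k * ((k : ℝ) * (η - ((1 - 2 * t) * S (z k) - (A.card : ℝ) * (c * t * Dbar)))) := by
      refine h1.trans (mul_le_mul_of_nonneg_left ?_ (div_nonneg (hqk0 k) hkr.le))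
      have : (k : ℝ) * (η - ((1 - 2 * t) * S (z k) - (A.card : ℝ) * (c * t * Dbar)))
          = (k : ℝ) * η - (k : ℝ) * ((1 - 2 * t) * S (z k) - (A.card : ℝ) * (c * t * Dbar)) := by ring
      rw [this]; linarith
    have e1 : qk k / k * ((k : ℝ) * (η - ((1 - 2 * t) * S (z k) - (A.card : ℝ) * (c * t * Dbar))))
        = qk k * (η - ((1 - 2 * t) * S (z k) - (A.card : ℝ) * (c * t * Dbar))) := by field_simp
    have e2 : qk k * (η - ((1 - 2 * t) * S (z k) - (A.card : ℝ) * (c * t * Dbar))) = qk k * (ηp - (1 - 2 * t) * S (z k)) := by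
      simp only [hηp_def, hDbar_def]
      linear_combination (qk k * (A.card : ℝ) ^ 2 * t * η) * hcc
    linarith
  -- PER ZONE: D_ζ ≤ Q_ζ·η₊ − Q_ζ(1 − 2t)·Σ_{ζ′>ζ} D_{ζ′}
  have hSZ : ∀ ζ, S ζ = ∑ ζ' ∈ Z.filter (fun ζ' => ζ < ζ'), DZ ζ' := by
    intro ζ
    simp only [hS_def, hDZ_def]
    rw [← sum_fiberwise_of_maps_to (s := A.filter (fun k' => ζ < z k')) (t := Z.filter (fun ζ' => ζ < ζ')) (g := z)
      (fun k' hk' => by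
        obtain ⟨hk'A, hζ⟩ := mem_filter.mp hk'
        exact mem_filter.mpr ⟨hmaps k' hk'A, hζ⟩)]
    refine sum_congr rfl fun ζ' hζ' => ?_
    obtain ⟨-, hζζ'⟩ := mem_filter.mp hζ'
    refine sum_congr ?_ fun _ _ => rfl
    ext k'
    simp only [mem_filter]
    exact ⟨fun ⟨⟨hk'A, _⟩, hz⟩ => ⟨hk'A, hz⟩, fun ⟨hk'A, hz⟩ => ⟨⟨hk'A, hz.symm ▸ hζζ'⟩, hz⟩⟩
  have hrec : ∀ ζ ∈ Z, DZ ζ ≤ QZ ζ * ηp - QZ ζ * (1 - 2 * t) * ∑ ζ' ∈ Z.filter (fun ζ' => ζ < ζ'), DZ ζ' := by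
    intro ζ _
    rw [← hSZ ζ]
    have : DZ ζ ≤ ∑ k ∈ A.filter (fun k => z k = ζ), qk k * (ηp - (1 - 2 * t) * S ζ) := by
      simp only [hDZ_def]
      refine sum_le_sum fun k hk => ?_
      obtain ⟨hkA, hzk⟩ := mem_filter.mp hk
      have := hage k hkA
      rw [hzk] at this
      exact this
    rw [← sum_mul] at this
    simp only [hQZ_def]
    linarith
  -- THE BUDGET RECURSION OVER THE ZONES and the assembly
  have hθ : ∀ ζ ∈ Z, 0 ≤ 1 - QZ ζ * (1 - 2 * t) := by
    intro ζ hζ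
    have : QZ ζ * (1 - 2 * t) ≤ 1 * 1 := mul_le_mul ((hQZq ζ hζ).trans hq1) (by linarith) h2t zero_le_one
    linarith
  have hbud := budget_prod h2t Z (fun ζ _ => hDZ0 ζ) hθ hrec
  have hprod : (1 - q) ^ Z.card ≤ ∏ ζ ∈ Z, (1 - QZ ζ * (1 - 2 * t)) :=
    pow_card_le_prod_of_le Z (by linarith) fun ζ hζ => by
      have : QZ ζ * (1 - 2 * t) ≤ q * 1 := mul_le_mul (hQZq ζ hζ) (by linarith) h2t hq0
      linarith
  have hasm := assembly_general (E := (A.card : ℝ) ^ 2) ht0 hη0 (by linarith : (0:ℝ) ≤ 1 - q) hprod (sq_nonneg _) ht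
  have htot : ∑ k ∈ A, Dk k = ∑ ζ ∈ Z, DZ ζ := by
    simp only [hDZ_def]; rw [sum_fiberwise_of_maps_to hmaps]
  -- conclude
  have hfin : B h - B h' ≤ η := by
    rw [hdrop0, htot]
    rcases A.eq_empty_or_nonempty with hA | hA
    · have : Z = ∅ := by rw [hZ_def, hA, Finset.image_empty]
      rw [this, sum_empty]; exact hη0
    · have hpos : 0 < 1 - 2 * t := by linarith [htle hA]
      have e : ηp * (1 - ∏ ζ ∈ Z, (1 - QZ ζ * (1 - 2 * t)))
          = η * (1 + (A.card : ℝ) ^ 2 * t / 2) * (1 - ∏ ζ ∈ Z, (1 - QZ ζ * (1 - 2 * t))) := by simp only [hηp_def]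
      have hchain : (1 - 2 * t) * ∑ ζ ∈ Z, DZ ζ ≤ (1 - 2 * t) * η := by linarith [hbud, hasm, e]
      exact le_of_mul_le_mul_left hchain hpos
  rw [hη_def] at hfin
  linarith

/-! ## §3 The comparison theorem -/

/-- **PROFILE-BOUNDED HYPER-SEPARATED ZONES COMPARE AT ANY SIZE** (family-free form of §2's step by (E58a)'s principle): `B = b + Σ_{k<K} L_k·u_k` on ]0,γ]
with `b > 0`, `L ≥ 0` supported on a finite `A ⊆ [1, K[`; a zone map `z` with `k ≤ t·k′` whenever `z k < z k′`; every zone passing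
`Σ_{j∈A, z j = ζ} L_j ∕ P_j ≤ 2q` (`0 ≤ q ≤ 1`); `(n² + 4)·t ≤ 2·(1 − q)^N`; `B′` with zeroth moment `M′ ≥ 0`, `B ≤ B′`, ISOTONE excess; `h`, `h′` ANY box
solutions of `B`, `B′` from one pin `p ∈ ]0,γ]`.  Then `h′ ≤ h` at EVERY scale.  One zone and `t = 0`: (E58b)'s `le_of_isotone_excess_affine_profile`;
singleton zones and `q = √2∕2`: (E62b)'s `le_of_isotone_excess_tower`. [folklore] -/
theorem le_of_isotone_excess_zones {p : ℝ} (hL : ∀ k, 0 ≤ L k) (hb : 0 < b) (hAK : A ⊆ range K) (hA1 : ∀ k ∈ A, 1 ≤ k)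
    (hsupp : ∀ k ∈ range K, k ∉ A → L k = 0) (ht0 : 0 ≤ t) (hsep : ∀ k ∈ A, ∀ k' ∈ A, z k < z k' → (k : ℝ) ≤ t * k')
    (hq0 : 0 ≤ q) (hq1 : q ≤ 1)
    (hzone : ∀ ζ ∈ A.image z, ∑ j ∈ A.filter (fun j => z j = ζ), L j / ∑ k ∈ range K, L k * Real.sqrt ((j : ℝ) / ((j : ℝ) + k)) ≤ 2 * q)
    (ht : ((A.card : ℝ) ^ 2 + 4) * t ≤ 2 * (1 - q) ^ (A.image z).card)
    (hB' : ∀ u u' : ℕ → ℝ, SeqBox γ u → SeqBox γ u' → ∀ D : ℝ, (∀ j, |u j - u' j| ≤ D) → |B' u - B' u'| ≤ M' * D) (hM' : 0 ≤ M')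
    (hexc : ∀ u, SeqBox γ u → (fun u : ℕ → ℝ => b + ∑ k ∈ range K, L k * u k) u ≤ B' u)
    (hDmono : ∀ u v : ℕ → ℝ, SeqBox γ u → SeqBox γ v → (∀ j, u j ≤ v j) →
      B' u - (fun u : ℕ → ℝ => b + ∑ k ∈ range K, L k * u k) u ≤ B' v - (fun u : ℕ → ℝ => b + ∑ k ∈ range K, L k * u k) v)
    (hp : 0 < p) (hpγ : p ≤ γ) (hh : SeqBox γ h) (hf : MemFlow (fun u : ℕ → ℝ => b + ∑ k ∈ range K, L k * u k) p h)
    (hh' : SeqBox γ h') (hf' : MemFlow B' p h') (j : ℕ) : h' j ≤ h j :=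
  le_of_isotone_excess_of_step (B := fun u : ℕ → ℝ => b + ∑ k ∈ range K, L k * u k) (affine_monotone hL)
    (affine_zerothMoment hL) (sum_nonneg fun k _ => hL k) hb (affine_floor hL) hB' hM' hexc hDmono
    (fun _ hy _ _ _ hu hfu hu' hfu' hle =>
      effective_le_of_family_le_at_zones hL hb hAK hA1 hsupp ht0 hsep hq0 hq1 hzone ht hexc hDmono hy hu hfu hu' hfu' hle)
    hp hpγ hh hf hh' hf' j

end Summit.QuantumFields.BalabanUV.Beta.EriceRemainderEnclosureHistoryAutonomyComparisonZones

end
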